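/-
Copyright (c) 2026 the pub-hodgecm-mathlib formalisation cell (harness21).  Prover seat hodgecm-mathlib-K2Liu-p12 (g2): Track B «K2-LIT»,
#184♮ = hLiu418 = stmt-HodgeConjecture-24832; Road Φ of socket #41, organ Φ4-EXACT (LEAD F0P6-plan ruling «M-157p»), method «E-det», file E3c:
THE VALUE `I(1,1) = +q_v · μ(B(0))` AT AN INERT PLACE.  THEOREMS ONLY (no `def`, no `instance`, no `notation`, no named-fact hypothesis, no `sorry`).
-/
import Summits.HodgeConjecture.HodgeConjecture.Theorems.K2LiuSkewLatticeHermitianCoordinates      -- ★ E3b (hence E3a): Hermitian coordinates on `S`, balls, det levels, pairing letters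
import Summits.HodgeConjecture.HodgeConjecture.Theorems.K2LiuResidueHermitianSingularCharacterSum  -- ★ (HS) (K2Liu-p10): `Σ_{ab = z₁² − d z₂²} ψ₀(pa + rb + 2(u₁z₁ − d u₂z₂)) = |k|`
import Literature.NumberTheory.Automorphic.QuadraticLocalUnramifiedUnitNorm                       -- ★ `valued_eq_one_of_valued_toPlace_eq_one`
import HarnessLib

/-!
# Crux `HLiu418`, Road Φ, organ Φ4-EXACT (E-det), file E3c: `∫_{B(−1) ∩ D(−1)} ψ(−τ tr(β t)) dμ = +q_v · μ(B(0))` AT AN INERT PLACE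

Cell `hodgecm-mathlib`, crux hLiu418 = `stmt-HodgeConjecture-24832` (helper lane), route `HCCMUnconditional`; squad K2 ∕ K2Liu, socket #41, organ Φ4-EXACT.
Frame of ★ `K2LiuGoodPlaceWhittakerBound` with `n = 2` at a place `v ∤ 2` of `F` INERT and UNRAMIFIED in `E` (`w₀ ∣ v`, `c • w₀ = w₀`,
`|ι_w ϖ|_w = exp(−1)`), `δ̂ = 1 ⊗ δ` a unit at `w₀` (so `{1, δ̂}` is an integral basis and `dd = δ²` is a non-square unit of `𝒪_v` modulo `𝔭_v`),
`ψ` of conductor exponent `0`, `β ∈ S ∩ GL₂(𝒪)` (`T`-skew, integral with integral inverse), `τ` the trace-type functional (`ι(τ r) = r + σ r`).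

THE COMPUTATION [KudlaRallis1994, §2; Shimura1997, §13.5–13.6].  By ★ E3b every `t ∈ S` is `X(a, b, z₁, z₂) = T⁻¹(δ̂ • H)`,
`H = (ι a, z; σ z, ι b)`, `z = ι z₁ + ι z₂ δ̂`, with `(a, b, z₁, z₂) ∈ F_v⁴` (★ `exists_coords`); `X ∈ B(m) ⟺ a, b, z₁, z₂ ∈ 𝔭_v^m`
(★ `coords_mem_of_mball`, ★ E3a `mball_coords`), `X ∈ D(m) ⟺ ab − (z₁² − dd z₂²) ∈ 𝔭_v^m` (★ `det_mball_iff`), and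
`τ tr(β X) = 2 dd·(p a + r b + 2(u₁ z₁ − dd u₂ z₂))` with `δ̂⁻¹ β T⁻¹ = (ι p, u; σ u, ι r)`, `u = ι u₁ + ι u₂ δ̂`, `p r − (u₁² − dd u₂²) ∈ 𝒪_v^×`
(★ E3b §2).  Hence `B(−1) = ⨆_{κ ∈ 𝓀⁴} (X(ϖ⁻¹ s(κ)) + B(0))`, the integrand is constant on cosets with value `ψ₀(d̄(p̄ κ₁ + r̄ κ₂ + 2(ū₁ κ₃ − d̄ ū₂ κ₄)))`
(`ψ₀(x̄) = ψ(−2ϖ⁻¹ x)`, ★ `exists_addChar_residue`), and `D(−1)` meets the `κ`-coset iff `κ₁ κ₂ = κ₃² − d̄ κ₄²` (§1 `quadric_coset_iff`, `addChar_coset_eq`); the finite sum is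
★ (HS) `sum_hermSingular_addChar` (at `d̄ p̄, d̄ r̄, d̄ ū`; `d̄` a non-square by the anisotropy ★ E3a `mem_primePowBall_one_of_norm`) `= |𝓀| = q_v`.
* **`setIntegral_ball_inter_det_eq_inert`** — THE VALUE, in the bytes of E5's `hI11` with `C = +q_v` (so E5 gives `μ(B0)(1 − t)(1 + q_v t)`).
HONEST LABEL.  Helper lemmas, count-neutral; `HC_CM` is proved only modulo the 7 printed citations (2 remaining named inputs:
hLiu418 = `stmt-HodgeConjecture-24832`, h413 = `stmt-HodgeConjecture-24833`) until rung 0 closes.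

## References
* [KudlaRallis1994] S. Kudla, S. Rallis, *A regularized Siegel–Weil formula: the first term identity*, Ann. of Math. 140 (1994), §2.
* [Shimura1997] G. Shimura, *Euler Products and Eisenstein Series*, CBMS 93 (1997), §13.5–13.6.
* [CasselsFrohlichANT1967] J. W. S. Cassels, A. Fröhlich (eds.), *Algebraic Number Theory* (1967), Ch. II §10, Ch. VII §1.1.   * [Tate1950] J. Tate, thesis, §2.2.
-/

set_option autoImplicit false
set_option linter.dupNamespace false -- the mandated namespace repeats `HodgeConjecture.HodgeConjecture`

noncomputable section

open scoped Matrix Valued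
open NumberField IsDedekindDomain Matrix MeasureTheory
open Literature.NumberTheory.Automorphic Literature.NumberTheory.Automorphic.UnitaryGroup
open Literature.NumberTheory.GelbartRogawski1991.UnitaryDualPair.LocalSplitting
open Summit.HodgeConjecture.HodgeConjecture.Cruxes.HLiu418.K2LiuLocalRingValuationBalls
open Summit.HodgeConjecture.HodgeConjecture.Cruxes.HLiu418.K2LiuResidueCharacterCosets
open Summit.HodgeConjecture.HodgeConjecture.Cruxes.HLiu418.K2LiuResidueHermitianSingularCharacterSum
open Summit.HodgeConjecture.HodgeConjecture.Cruxes.HLiu418.K2LiuSkewLatticeInertCoordinates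
open Summit.HodgeConjecture.HodgeConjecture.Cruxes.HLiu418.K2LiuSkewLatticeHermitianCoordinates

namespace Summit.HodgeConjecture.HodgeConjecture.Cruxes.HLiu418.K2LiuSkewResidueQuadricInert

variable (F : Type) [Field F] [NumberField F] (E : Type) [Field E] [NumberField E] [Algebra F E]
  [Algebra.IsQuadraticExtension F E] (c : E ≃ₐ[F] E) {δ : E} (hcδ : c δ = -δ) (hδ : δ ≠ 0) {dd : F} (hd : δ * δ = algebraMap F E dd)
  (v : HeightOneSpectrum (𝓞 F)) {T₀ : Matrix (Fin 2) (Fin 2) F} {π : v.adicCompletion F} (hπ : Valued.v π = WithZero.exp (-1 : ℤ))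
  {τ : LocalRing E v → v.adicCompletion F}

/-! ## §1 The residue quadric: the determinant condition on a coset, the coset value, non-degeneracy, anisotropy -/

include hπ in
omit [NumberField E] [Algebra.IsQuadraticExtension F E] in
/-- **the determinant condition on a coset**: for sections `s₁,…,s₄ ∈ 𝒪_v` of `κ ∈ 𝓀⁴`, integral `h₁,…,h₄` and `dd ∈ 𝒪_v`,
`(ϖ⁻¹s₁ + h₁)(ϖ⁻¹s₂ + h₂) − ((ϖ⁻¹s₃ + h₃)² − dd (ϖ⁻¹s₄ + h₄)²) ∈ 𝔭_v⁻¹ ⟺ κ₁κ₂ − (κ₃² − d̄ κ₄²) = 0` (reduce `ϖ²·(…) ∈ 𝒪` modulo `𝔪`).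
[cite: KudlaRallis1994, §2] -/
theorem quadric_coset_iff (s₁ s₂ s₃ s₄ ddO : 𝒪[v.adicCompletion F]) {h₁ h₂ h₃ h₄ : v.adicCompletion F}
    (hh₁ : Valued.v h₁ ≤ 1) (hh₂ : Valued.v h₂ ≤ 1) (hh₃ : Valued.v h₃ ≤ 1) (hh₄ : Valued.v h₄ ≤ 1) :
    (π⁻¹ * (s₁ : v.adicCompletion F) + h₁) * (π⁻¹ * (s₂ : v.adicCompletion F) + h₂) -
        ((π⁻¹ * (s₃ : v.adicCompletion F) + h₃) ^ 2 - (ddO : v.adicCompletion F) * (π⁻¹ * (s₄ : v.adicCompletion F) + h₄) ^ 2) ∈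
        primePowBall (v.adicCompletion F) (-1) ↔
      IsLocalRing.residue _ s₁ * IsLocalRing.residue _ s₂ -
        (IsLocalRing.residue _ s₃ ^ 2 - IsLocalRing.residue _ ddO * IsLocalRing.residue _ s₄ ^ 2) = 0 := by
  obtain ⟨hπ0, hvπ0, hπlt, hπle⟩ := uniformizer_facts F v hπ
  have hpos : 0 < Valued.v π := zero_lt_iff.2 hvπ0
  set πO : 𝒪[v.adicCompletion F] := ⟨π, hπle⟩ with hπO
  set MO : 𝒪[v.adicCompletion F] := (s₁ + πO * ⟨h₁, hh₁⟩) * (s₂ + πO * ⟨h₂, hh₂⟩) -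
      ((s₃ + πO * ⟨h₃, hh₃⟩) ^ 2 - ddO * (s₄ + πO * ⟨h₄, hh₄⟩) ^ 2) with hMO
  have hexp : (π⁻¹ * (s₁ : v.adicCompletion F) + h₁) * (π⁻¹ * (s₂ : v.adicCompletion F) + h₂) -
      ((π⁻¹ * (s₃ : v.adicCompletion F) + h₃) ^ 2 - (ddO : v.adicCompletion F) * (π⁻¹ * (s₄ : v.adicCompletion F) + h₄) ^ 2) =
      (π ^ 2)⁻¹ * (MO : v.adicCompletion F) := by
    have e : ∀ (s : 𝒪[v.adicCompletion F]) (h : v.adicCompletion F), π⁻¹ * (s : v.adicCompletion F) + h = π⁻¹ * (s + π * h) := fun s h => by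
      rw [mul_add, ← mul_assoc π⁻¹ π h, inv_mul_cancel₀ hπ0, one_mul]
    rw [e, e, e, e, hMO]
    push_cast
    ring
  have hres : IsLocalRing.residue _ MO = IsLocalRing.residue _ s₁ * IsLocalRing.residue _ s₂ -
      (IsLocalRing.residue _ s₃ ^ 2 - IsLocalRing.residue _ ddO * IsLocalRing.residue _ s₄ ^ 2) := by
    have hπr : IsLocalRing.residue _ πO = 0 := (UnitaryLatticeTree.residue_eq_zero_iff_v_lt_one πO).2 hπlt
    rw [hMO]; simp only [map_sub, map_mul, map_add, map_pow, hπr, zero_mul, add_zero]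
  rw [mem_primePowBall_adicCompletion_iff, hexp, neg_neg, map_mul, map_inv₀, map_pow, ← hres,
    UnitaryLatticeTree.residue_eq_zero_iff_v_lt_one, v_lt_one_iff_le F v hπ,
    show WithZero.exp (1 : ℤ) = (Valued.v π)⁻¹ by rw [hπ, ← WithZero.exp_neg, neg_neg],
    inv_mul_le_iff₀ (pow_pos hpos 2), sq, mul_assoc, mul_inv_cancel₀ hvπ0, mul_one]

/-- **the integrand on the coset of `κ ∈ 𝓀⁴`**: if `τ tr(β X(a,b,z₁,z₂)) = 2e(p a + r b + 2(u₁ z₁ − e u₂ z₂))` with `e, p, r, u₁, u₂ ∈ 𝒪_v`, then at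
`X(ϖ⁻¹ s(κ))` the character `ψ(−τ tr(β ·))` takes the value `ψ₀(ē(p̄ κ₁ + r̄ κ₂ + 2(ū₁ κ₃ − ē ū₂ κ₄)))`, `ψ₀(x̄) = ψ(−2ϖ⁻¹x)`.
[cite: KudlaRallis1994, §2] [cite: Tate1950, §2.2] -/
theorem addChar_coset_eq {ψ : AddChar (v.adicCompletion F) Circle} {ψ₀ : AddChar 𝓀[v.adicCompletion F] ℂ}
    (hψ₀ : ∀ x : 𝒪[v.adicCompletion F], ψ₀ (IsLocalRing.residue _ x) = ((ψ (-(2 * (π⁻¹ * (x : v.adicCompletion F))))) : ℂ))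
    {sec : 𝓀[v.adicCompletion F] → 𝒪[v.adicCompletion F]} (hsec : ∀ a, IsLocalRing.residue _ (sec a) = a)
    {β : Matrix (Fin 2) (Fin 2) (LocalRing E v)} {ε : LocalRing E v} (eO pO rO u₁O u₂O : 𝒪[v.adicCompletion F])
    (hpair : ∀ a b z₁ z₂ : v.adicCompletion F, τ (Matrix.trace (β * ((gramS F E v 2 T₀)⁻¹ * (ε •
        !![toLocalRing E v a, quadraticLocalEquiv E v c hcδ hδ (z₁, z₂); conjLocal E c v (quadraticLocalEquiv E v c hcδ hδ (z₁, z₂)), toLocalRing E v b])))) =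
      2 * (eO : v.adicCompletion F) * ((pO : v.adicCompletion F) * a + (rO : v.adicCompletion F) * b +
        2 * ((u₁O : v.adicCompletion F) * z₁ - (eO : v.adicCompletion F) * (u₂O : v.adicCompletion F) * z₂)))
    (κ : 𝓀[v.adicCompletion F] × 𝓀[v.adicCompletion F] × 𝓀[v.adicCompletion F] × 𝓀[v.adicCompletion F]) :
    ((ψ (-τ (Matrix.trace (β * ((gramS F E v 2 T₀)⁻¹ * (ε •
        !![toLocalRing E v (π⁻¹ * (sec κ.1 : v.adicCompletion F)), quadraticLocalEquiv E v c hcδ hδ (π⁻¹ * (sec κ.2.2.1 : v.adicCompletion F), π⁻¹ * (sec κ.2.2.2 : v.adicCompletion F));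
          conjLocal E c v (quadraticLocalEquiv E v c hcδ hδ (π⁻¹ * (sec κ.2.2.1 : v.adicCompletion F), π⁻¹ * (sec κ.2.2.2 : v.adicCompletion F))),
          toLocalRing E v (π⁻¹ * (sec κ.2.1 : v.adicCompletion F))]))))) : Circle) : ℂ) =
      ψ₀ (IsLocalRing.residue _ eO * (IsLocalRing.residue _ pO * κ.1 + IsLocalRing.residue _ rO * κ.2.1 +
        2 * (IsLocalRing.residue _ u₁O * κ.2.2.1 - IsLocalRing.residue _ eO * IsLocalRing.residue 𝒪[v.adicCompletion F] u₂O * κ.2.2.2))) := by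
  have hx := hψ₀ (eO * (pO * sec κ.1 + rO * sec κ.2.1 + 2 * (u₁O * sec κ.2.2.1 - eO * u₂O * sec κ.2.2.2)))
  simp only [map_mul, map_add, map_sub, map_ofNat, hsec] at hx
  rw [hx, hpair]
  congr 3
  have h2c : ((2 : 𝒪[v.adicCompletion F]) : v.adicCompletion F) = 2 := rfl
  push_cast
  rw [h2c]
  ring

omit [NumberField E] [Algebra.IsQuadraticExtension F E] in
/-- **non-degeneracy of the residue form** `ē p̄ · ē r̄ − ((ē ū₁)² − ē (ē ū₂)²) = ē²·(p̄ r̄ − (ū₁² − ē ū₂²)) ≠ 0` when `e` and `p r − (u₁² − e u₂²)` are units.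
[cite: KudlaRallis1994, §2] -/
theorem residue_form_ne_zero (eO pO rO u₁O u₂O : 𝒪[v.adicCompletion F]) (he : Valued.v (eO : v.adicCompletion F) = 1)
    (hN : Valued.v ((pO : v.adicCompletion F) * rO - ((u₁O : v.adicCompletion F) ^ 2 - (eO : v.adicCompletion F) * (u₂O : v.adicCompletion F) ^ 2)) = 1) :
    IsLocalRing.residue _ eO * IsLocalRing.residue _ pO * (IsLocalRing.residue _ eO * IsLocalRing.residue _ rO) -
      ((IsLocalRing.residue _ eO * IsLocalRing.residue _ u₁O) ^ 2 -
        IsLocalRing.residue _ eO * (IsLocalRing.residue _ eO * IsLocalRing.residue 𝒪[v.adicCompletion F] u₂O) ^ 2) ≠ 0 := by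
  have hNO : IsLocalRing.residue 𝒪[v.adicCompletion F] (pO * rO - (u₁O ^ 2 - eO * u₂O ^ 2)) ≠ 0 := by
    rw [Ne, UnitaryLatticeTree.residue_eq_zero_iff_v_lt_one, not_lt]
    have hc : ((pO * rO - (u₁O ^ 2 - eO * u₂O ^ 2) : 𝒪[v.adicCompletion F]) : v.adicCompletion F) =
        (pO : v.adicCompletion F) * rO - ((u₁O : v.adicCompletion F) ^ 2 - (eO : v.adicCompletion F) * (u₂O : v.adicCompletion F) ^ 2) := by
      push_cast; ring
    rw [hc, hN]
  have he0 : IsLocalRing.residue 𝒪[v.adicCompletion F] eO ≠ 0 := by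
    rw [Ne, UnitaryLatticeTree.residue_eq_zero_iff_v_lt_one, not_lt]; exact he.symm.le
  rw [map_sub, map_mul, map_sub, map_pow, map_mul, map_pow] at hNO
  intro h
  refine hNO ((mul_eq_zero.1 ?_).resolve_left (pow_ne_zero 2 he0))
  rw [← h]; ring

section InertPlace

variable (w₀ : PlacesOver E v) (hw₀ : c • w₀.1 = w₀.1) (hπw : ∀ w : PlacesOver E v, Valued.v (toPlace v w π) = WithZero.exp (-1 : ℤ))

include hcδ hδ hd hπ hw₀ hπw in
/-- **`d̄` is a non-square in `𝓀(F_v)`** at an inert unramified place with `δ̂`, `2` units (a square root `ȳ` of `d̄` would give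
`y² − dd·1² ∈ 𝔭_v` with `y, 1 ∈ 𝒪_v`, contradicting the anisotropy ★ E3a `mem_primePowBall_one_of_norm`). [cite: CasselsFrohlichANT1967, Ch. VII §1.1] -/
theorem not_isSquare_residue (hτ : ∀ r, toLocalRing E v (τ r) = r + conjLocal E c v r) (hτadd : ∀ r s, τ (r + s) = τ r + τ s)
    (hτs : ∀ (z : v.adicCompletion F) (r : LocalRing E v), τ (toLocalRing E v z * r) = z * τ r)
    (h2F : Valued.v (2 : v.adicCompletion F) = 1) (hddv : Valued.v (dd : v.adicCompletion F) = 1)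
    (hδw : ∀ w : PlacesOver E v, Valued.v (algebraMap E (LocalRing E v) δ w) ≤ Valued.v (toPlace v w π) ^ (0 : ℤ)) :
    ¬ IsSquare (IsLocalRing.residue 𝒪[v.adicCompletion F] ⟨(dd : v.adicCompletion F), hddv.le⟩) := by
  rintro ⟨y, hy⟩
  obtain ⟨x, hx⟩ := IsLocalRing.residue_surjective y
  have h0 : IsLocalRing.residue 𝒪[v.adicCompletion F] (x * x - ⟨(dd : v.adicCompletion F), hddv.le⟩) = 0 := by
    rw [map_sub, map_mul, hx, ← hy, sub_self]
  rw [UnitaryLatticeTree.residue_eq_zero_iff_v_lt_one, v_lt_one_iff_le F v hπ] at h0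
  have hN : (x : v.adicCompletion F) ^ 2 - (dd : v.adicCompletion F) * 1 ^ 2 ∈ primePowBall (v.adicCompletion F) 1 := by
    rw [mem_primePowBall_adicCompletion_iff, one_pow, mul_one, sq, ← hπ]
    exact h0
  have hx0 : (x : v.adicCompletion F) ∈ primePowBall (v.adicCompletion F) 0 :=
    (mem_primePowBall_adicCompletion_iff v).2 (by rw [neg_zero, WithZero.exp_zero]; exact x.2)
  have h1 : (1 : v.adicCompletion F) ∈ primePowBall (v.adicCompletion F) 0 :=
    (mem_primePowBall_adicCompletion_iff v).2 (by rw [neg_zero, WithZero.exp_zero, map_one])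
  have h := (mem_primePowBall_one_of_norm F E c hcδ hδ hd v hπ w₀ hw₀ hτ hτadd hτs h2F hddv hδw hπw hx0 h1 hN).2
  rw [mem_primePowBall_adicCompletion_iff, map_one, ← WithZero.exp_zero, WithZero.exp_le_exp] at h
  omega


/-! ## §2 THE VALUE at an inert place -/

include hcδ hδ hd hπ hw₀ hπw in
/-- **`I(1,1) = +q_v · μ(B(0))` AT AN INERT UNRAMIFIED PLACE** (K2Liu-p12 (g2)'s interface (V)-inert, consumed by ★ E5 as `hI11` with `C = +q_v`):
for `ψ_v` of conductor exponent `0`, `|2|_v = 1`, `δ̂` a unit at `w₀`, `β ∈ S ∩ GL₂(𝒪)` and `v` inert and unramified in `E`,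
`∫_{B(−1) ∩ D(−1)} ψ_v(−τ tr(β t)) dμ(t) = +q_v · μ(B(0))`.
Proof: `B(−1) = ⨆_{κ ∈ 𝓀⁴} (X(ϖ⁻¹ s(κ)) + B(0))` in the Hermitian coordinates of ★ E3a, the integrand is `ψ₀(d̄·(p̄κ₁ + r̄κ₂ + 2(ū₁κ₃ − d̄ū₂κ₄)))`
on the `κ`-coset and `D(−1)` meets it iff `κ₁κ₂ = κ₃² − d̄κ₄²` (`setIntegral_eq_sum_cosets`); then ★ (HS) `sum_hermSingular_addChar` (`d̄` a non-square,
`p̄r̄ − (ū₁² − d̄ū₂²) ≠ 0`) and `|𝓀| = q_v`. [cite: KudlaRallis1994, §2] [cite: Shimura1997, §13.6] [cite: Tate1950, §2.2] -/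
theorem setIntegral_ball_inter_det_eq_inert (hT₀ : T₀.IsSymm) (hT₀d : IsUnit T₀.det)
    (S : AddSubgroup (Matrix (Fin 2) (Fin 2) (LocalRing E v)))
    (hS : ∀ t, t ∈ S ↔ (t.map (conjLocal E c v))ᵀ * gramS F E v 2 T₀ + gramS F E v 2 T₀ * t = 0)
    [MeasurableSpace S] [BorelSpace S] (μ : Measure S) [μ.IsAddHaarMeasure]
    {ψ : AddChar (v.adicCompletion F) Circle} (hdψ : ψ.HasConductorExp 0)
    (hτ : ∀ r, toLocalRing E v (τ r) = r + conjLocal E c v r) (hτadd : ∀ r s, τ (r + s) = τ r + τ s)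
    (hτs : ∀ (z : v.adicCompletion F) (r : LocalRing E v), τ (toLocalRing E v z * r) = z * τ r)
    (h2F : Valued.v (2 : v.adicCompletion F) = 1)
    (hδu : ∀ w : PlacesOver E v, Valued.v (algebraMap E (LocalRing E v) δ w) = 1)
    {β βinv : Matrix (Fin 2) (Fin 2) (LocalRing E v)}
    (hβskew : (β.map (conjLocal E c v))ᵀ * gramS F E v 2 T₀ + gramS F E v 2 T₀ * β = 0) (hββ : β * βinv = 1)
    (hβ : ∀ i j (w : PlacesOver E v), Valued.v (β i j w) ≤ Valued.v (toPlace v w π) ^ (0 : ℤ))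
    (hβinv : ∀ i j (w : PlacesOver E v), Valued.v (βinv i j w) ≤ Valued.v (toPlace v w π) ^ (0 : ℤ))
    (hTb : ∀ i j (w : PlacesOver E v), Valued.v (gramS F E v 2 T₀ i j w) ≤ Valued.v (toPlace v w π) ^ (0 : ℤ))
    (hTib : ∀ i j (w : PlacesOver E v), Valued.v ((gramS F E v 2 T₀)⁻¹ i j w) ≤ Valued.v (toPlace v w π) ^ (0 : ℤ)) :
    ∫ t in {t : S | ∀ i j (w : PlacesOver E v), Valued.v (t.1 i j w) ≤ Valued.v (toPlace v w π) ^ (-1 : ℤ)} ∩ {t : S | ∀ w : PlacesOver E v, Valued.v (t.1.det w) ≤ Valued.v (toPlace v w π) ^ (-1 : ℤ)}, ((ψ (-τ (Matrix.trace (β * t.1))) : Circle) : ℂ) ∂μ = (v.residueCard : ℂ) * (μ.real {t : S | ∀ i j (w : PlacesOver E v), Valued.v (t.1 i j w) ≤ Valued.v (toPlace v w π) ^ (0 : ℤ)} : ℂ) := by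
  classical
  obtain ⟨hπ0, hvπ0, hπlt, hπle⟩ := uniformizer_facts F v hπ
  have hpos : 0 < Valued.v π := zero_lt_iff.2 hvπ0
  have hexp1 : WithZero.exp (1 : ℤ) = (Valued.v π)⁻¹ := by rw [hπ, ← WithZero.exp_neg, neg_neg]
  have h20 : (2 : v.adicCompletion F) ≠ 0 := fun h0 => by rw [h0, map_zero] at h2F; exact zero_ne_one h2F
  have hmem0 : ∀ {a : v.adicCompletion F}, a ∈ primePowBall (v.adicCompletion F) 0 ↔ Valued.v a ≤ 1 := fun {a} => by
    rw [mem_primePowBall_adicCompletion_iff, neg_zero, WithZero.exp_zero]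
  -- `δ̂` as an anti-invariant unit `εu` of `R = E ⊗ F_v`; `dd` is a unit of `𝒪_v`
  have hδδ : algebraMap E (LocalRing E v) δ * algebraMap E (LocalRing E v) δ = toLocalRing E v (dd : v.adicCompletion F) := by
    rw [← map_mul, hd, toLocalRing_coe]
  have hddv : Valued.v (dd : v.adicCompletion F) = 1 := by
    refine valued_eq_one_of_valued_toPlace_eq_one E v w₀ ?_
    rw [← toLocalRing_apply, ← hδδ, Pi.mul_apply, map_mul, hδu, one_mul]
  have hdd0 : (dd : v.adicCompletion F) ≠ 0 := fun h0 => by rw [h0, map_zero] at hddv; exact zero_ne_one hddv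
  let εu : (LocalRing E v)ˣ := ⟨algebraMap E (LocalRing E v) δ, toLocalRing E v (dd : v.adicCompletion F)⁻¹ * algebraMap E (LocalRing E v) δ,
    by rw [mul_left_comm, hδδ, ← map_mul, inv_mul_cancel₀ hdd0, map_one],
    by rw [mul_assoc, hδδ, ← map_mul, inv_mul_cancel₀ hdd0, map_one]⟩
  have hεu : (εu : LocalRing E v) = algebraMap E (LocalRing E v) δ := rfl
  have hεσ : conjLocal E c v (εu : LocalRing E v) = -(εu : LocalRing E v) := by rw [hεu, conjLocal_algebraMap, hcδ, map_neg]
  have hεv : ∀ w : PlacesOver E v, Valued.v ((εu : LocalRing E v) w) = 1 := fun w => by rw [hεu]; exact hδu w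
  have hεint : ∀ w : PlacesOver E v, Valued.v ((εu : LocalRing E v) w) ≤ Valued.v (toPlace v w π) ^ (0 : ℤ) := fun w => (hεv w).le.trans_eq (zpow_zero _).symm
  have hεinv : ∀ w : PlacesOver E v, Valued.v ((↑εu⁻¹ : LocalRing E v) w) ≤ Valued.v (toPlace v w π) ^ (0 : ℤ) := fun w => by
    have h := congrArg (fun x : LocalRing E v => Valued.v (x w)) (Units.inv_mul εu)
    simp only [Pi.mul_apply, map_mul, Pi.one_apply, map_one, hεv, mul_one] at h
    rw [zpow_zero]; exact h.le
  have he : 2⁻¹ * τ ((εu : LocalRing E v) ^ 2) = (dd : v.adicCompletion F) := by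
    rw [sq, hεu, hδδ, tau_toLocalRing F E c v hτ hτs, ← mul_assoc, inv_mul_cancel₀ h20, one_mul]
  -- the residue field `𝓀 = 𝓀(F_v)`, a section of the residue map, the character `ψ₀(x̄) = ψ(−2ϖ⁻¹x)`
  haveI : Finite 𝓀[v.adicCompletion F] := finite_residueField F v
  letI : Fintype 𝓀[v.adicCompletion F] := Fintype.ofFinite _
  obtain ⟨sec, hsec⟩ : ∃ sec : 𝓀[v.adicCompletion F] → 𝒪[v.adicCompletion F], ∀ a, IsLocalRing.residue _ (sec a) = a :=
    ⟨Function.surjInv IsLocalRing.residue_surjective, Function.surjInv_eq IsLocalRing.residue_surjective⟩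
  obtain ⟨ψ₀, hψ₀1, hψ₀⟩ := exists_addChar_residue F v hπ hdψ h2F
  -- the pairing letters of `β` and the unit `p r − (u₁² − dd u₂²)`
  obtain ⟨p, r, u₁, u₂, hp, hr, hu₁, hu₂, hBeq, hpair⟩ :=
    exists_pairing_letters F E c hcδ hδ hd v hπ hT₀ hT₀d hτ hτadd hτs h2F hddv hεint hTib εu hεσ hεinv hβskew hβ
  have hNB : Valued.v (p * r - (u₁ ^ 2 - (dd : v.adicCompletion F) * u₂ ^ 2)) = 1 :=
    valued_eq_one_of_valued_toPlace_eq_one E v w₀ (valued_toPlace_pairing_det F E c hcδ hδ hd v hπ hT₀d hTb hTib εu hεv hββ hβ hβinv hBeq w₀)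
  set ddO : 𝒪[v.adicCompletion F] := ⟨(dd : v.adicCompletion F), hddv.le⟩ with hddO
  set pO : 𝒪[v.adicCompletion F] := ⟨p, hp⟩ with hpO
  set rO : 𝒪[v.adicCompletion F] := ⟨r, hr⟩ with hrO
  set u₁O : 𝒪[v.adicCompletion F] := ⟨u₁, hu₁⟩ with hu₁O
  set u₂O : 𝒪[v.adicCompletion F] := ⟨u₂, hu₂⟩ with hu₂O
  have hnsq : ¬ IsSquare (IsLocalRing.residue 𝒪[v.adicCompletion F] ddO) :=
    not_isSquare_residue F E c hcδ hδ hd v hπ w₀ hw₀ hπw hτ hτadd hτs h2F hddv hεint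
  have hβ' := residue_form_ne_zero F v ddO pO rO u₁O u₂O hddv hNB
  have hpair' : ∀ a b z₁ z₂ : v.adicCompletion F, τ (Matrix.trace (β * ((gramS F E v 2 T₀)⁻¹ * ((εu : LocalRing E v) •
      !![toLocalRing E v a, quadraticLocalEquiv E v c hcδ hδ (z₁, z₂); conjLocal E c v (quadraticLocalEquiv E v c hcδ hδ (z₁, z₂)), toLocalRing E v b])))) =
      2 * (ddO : v.adicCompletion F) * ((pO : v.adicCompletion F) * a + (rO : v.adicCompletion F) * b +
        2 * ((u₁O : v.adicCompletion F) * z₁ - (ddO : v.adicCompletion F) * (u₂O : v.adicCompletion F) * z₂)) := fun a b z₁ z₂ => by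
    rw [hpair, he]
  -- the coordinate family `X(a, b, z₁, z₂) = T⁻¹(δ̂ • H(a, b, z₁, z₂))` (★ E3b)
  have hsk : ∀ t : S, (t.1.map (conjLocal E c v))ᵀ * gramS F E v 2 T₀ + gramS F E v 2 T₀ * t.1 = 0 := fun t => (hS t.1).1 t.2
  let Xc : v.adicCompletion F → v.adicCompletion F → v.adicCompletion F → v.adicCompletion F → Matrix (Fin 2) (Fin 2) (LocalRing E v) :=
    fun a b z₁ z₂ => (gramS F E v 2 T₀)⁻¹ * ((εu : LocalRing E v) •
      !![toLocalRing E v a, quadraticLocalEquiv E v c hcδ hδ (z₁, z₂); conjLocal E c v (quadraticLocalEquiv E v c hcδ hδ (z₁, z₂)), toLocalRing E v b])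
  have hXS : ∀ a b z₁ z₂, Xc a b z₁ z₂ ∈ S := fun a b z₁ z₂ => (hS _).2 (skew_coords F E c hcδ hδ v hT₀ hT₀d hεσ a b _)
  have hXadd : ∀ a b z₁ z₂ a' b' z₁' z₂', Xc a b z₁ z₂ + Xc a' b' z₁' z₂' = Xc (a + a') (b + b') (z₁ + z₁') (z₂ + z₂') :=
    fun a b z₁ z₂ a' b' z₁' z₂' => coordMatrix_add F E c hcδ hδ v (εu : LocalRing E v) a b z₁ z₂ a' b' z₁' z₂'
  have hXneg : ∀ a b z₁ z₂, -Xc a b z₁ z₂ = Xc (-a) (-b) (-z₁) (-z₂) :=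
    fun a b z₁ z₂ => coordMatrix_neg F E c hcδ hδ v (εu : LocalRing E v) a b z₁ z₂
  have hXball : ∀ (m : ℤ) {a b z₁ z₂ : v.adicCompletion F}, a ∈ primePowBall (v.adicCompletion F) m → b ∈ primePowBall (v.adicCompletion F) m →
      z₁ ∈ primePowBall (v.adicCompletion F) m → z₂ ∈ primePowBall (v.adicCompletion F) m →
      ∀ i j (w : PlacesOver E v), Valued.v (Xc a b z₁ z₂ i j w) ≤ Valued.v (toPlace v w π) ^ m :=
    fun m a b z₁ z₂ ha hb hz₁ hz₂ => mball_coords F E c v hπ hεint hTib ha hb (ball_of_coords_mem F E c hcδ hδ v hπ hεint hz₁ hz₂)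
  have hXcoords : ∀ (m : ℤ) {a b z₁ z₂ : v.adicCompletion F}, (∀ i j (w : PlacesOver E v), Valued.v (Xc a b z₁ z₂ i j w) ≤ Valued.v (toPlace v w π) ^ m) →
      a ∈ primePowBall (v.adicCompletion F) m ∧ b ∈ primePowBall (v.adicCompletion F) m ∧
        z₁ ∈ primePowBall (v.adicCompletion F) m ∧ z₂ ∈ primePowBall (v.adicCompletion F) m :=
    fun m a b z₁ z₂ h => coords_mem_of_mball F E c hcδ hδ hd v hπ hT₀d hτ hτadd hτs h2F hddv hεint hTb εu hεinv h
  have hXdet : ∀ (m : ℤ) (a b z₁ z₂ : v.adicCompletion F), (∀ w : PlacesOver E v, Valued.v ((Xc a b z₁ z₂).det w) ≤ Valued.v (toPlace v w π) ^ m) ↔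
      a * b - (z₁ ^ 2 - (dd : v.adicCompletion F) * z₂ ^ 2) ∈ primePowBall (v.adicCompletion F) m :=
    fun m a b z₁ z₂ => det_mball_iff F E c hcδ hδ hd v hπ hT₀d hTb hTib εu hεv m a b z₁ z₂
  -- scalar letters: `ϖ⁻¹ s ∈ 𝔭⁻¹`, `ϖ a ∈ 𝒪` for `a ∈ 𝔭⁻¹`, lifts
  have hπinv : ∀ s : 𝒪[v.adicCompletion F], π⁻¹ * (s : v.adicCompletion F) ∈ primePowBall (v.adicCompletion F) (-1) := fun s => by
    rw [mem_primePowBall_adicCompletion_iff, neg_neg, hexp1, map_mul, map_inv₀]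
    exact (mul_le_mul' le_rfl s.2).trans_eq (mul_one _)
  have hπmul : ∀ {a : v.adicCompletion F}, a ∈ primePowBall (v.adicCompletion F) (-1) → Valued.v (π * a) ≤ 1 := fun {a} ha => by
    rw [mem_primePowBall_adicCompletion_iff, neg_neg, hexp1] at ha
    rw [map_mul]; exact (mul_le_mul' le_rfl ha).trans_eq (mul_inv_cancel₀ hvπ0)
  have hdiff : ∀ {a : v.adicCompletion F} (ha : Valued.v (π * a) ≤ 1),
      -(π⁻¹ * (sec (IsLocalRing.residue _ ⟨π * a, ha⟩) : v.adicCompletion F)) + a ∈ primePowBall (v.adicCompletion F) 0 := by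
    intro a ha
    have hval : -(π⁻¹ * (sec (IsLocalRing.residue _ ⟨π * a, ha⟩) : v.adicCompletion F)) + a =
        π⁻¹ * (π * a - (sec (IsLocalRing.residue _ ⟨π * a, ha⟩) : v.adicCompletion F)) := by
      rw [mul_sub, inv_mul_cancel_left₀ hπ0, neg_add_eq_sub]
    rw [hmem0, hval, map_mul, map_inv₀, inv_mul_le_iff₀ hpos, mul_one]
    exact (residue_eq_iff F v hπ ⟨π * a, ha⟩ _).1 (hsec _).symm
  have hres_eq : ∀ x y : 𝒪[v.adicCompletion F],
      -(π⁻¹ * (y : v.adicCompletion F)) + π⁻¹ * (x : v.adicCompletion F) ∈ primePowBall (v.adicCompletion F) 0 →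
      IsLocalRing.residue _ x = IsLocalRing.residue _ y := by
    intro x y h
    rw [hmem0, neg_add_eq_sub, ← mul_sub, map_mul, map_inv₀, inv_mul_le_iff₀ hpos, mul_one] at h
    exact (residue_eq_iff F v hπ x y).2 h
  -- `B(0)` as a subgroup of `S`
  let H0 : AddSubgroup S :=
    { carrier := {t : S | ∀ i j (w : PlacesOver E v), Valued.v (t.1 i j w) ≤ Valued.v (toPlace v w π) ^ (0 : ℤ)}
      add_mem' := fun {x y} hx hy i j w => by
        rw [AddSubgroup.coe_add, Matrix.add_apply, Pi.add_apply]
        exact (Valuation.map_add _ _ _).trans (max_le (hx i j w) (hy i j w))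
      zero_mem' := fun i j w => by rw [AddSubgroup.coe_zero, Matrix.zero_apply, Pi.zero_apply, Valuation.map_zero]; exact zero_le
      neg_mem' := fun {x} hx i j w => by rw [AddSubgroup.coe_neg, Matrix.neg_apply, Pi.neg_apply, Valuation.map_neg]; exact hx i j w }
  have hH0 : ∀ {h : S}, h ∈ H0 → ∀ i j (w : PlacesOver E v), Valued.v (h.1 i j w) ≤ Valued.v (toPlace v w π) ^ (0 : ℤ) := fun hh => hh
  have hAm : ∀ {t : S}, t ∈ {t : S | ∀ i j (w : PlacesOver E v), Valued.v (t.1 i j w) ≤ Valued.v (toPlace v w π) ^ (-1 : ℤ)} →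
      ∀ i j (w : PlacesOver E v), Valued.v (t.1 i j w) ≤ Valued.v (toPlace v w π) ^ (-1 : ℤ) := fun ht => ht
  -- the coset representatives `ρ κ = X(ϖ⁻¹ s(κ))`, `κ ∈ 𝓀⁴`
  let ρ : 𝓀[v.adicCompletion F] × 𝓀[v.adicCompletion F] × 𝓀[v.adicCompletion F] × 𝓀[v.adicCompletion F] → S := fun κ =>
    ⟨Xc (π⁻¹ * (sec κ.1 : v.adicCompletion F)) (π⁻¹ * (sec κ.2.1 : v.adicCompletion F)) (π⁻¹ * (sec κ.2.2.1 : v.adicCompletion F))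
      (π⁻¹ * (sec κ.2.2.2 : v.adicCompletion F)), hXS _ _ _ _⟩
  have hρ : ∀ κ, (ρ κ).1 = Xc (π⁻¹ * (sec κ.1 : v.adicCompletion F)) (π⁻¹ * (sec κ.2.1 : v.adicCompletion F))
      (π⁻¹ * (sec κ.2.2.1 : v.adicCompletion F)) (π⁻¹ * (sec κ.2.2.2 : v.adicCompletion F)) := fun κ => rfl
  -- (A) every coset `ρ κ + B(0)` lies in `B(−1)`
  have hA : ∀ κ (h : S), h ∈ H0 → ρ κ + h ∈ {t : S | ∀ i j (w : PlacesOver E v), Valued.v (t.1 i j w) ≤ Valued.v (toPlace v w π) ^ (-1 : ℤ)} := by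
    intro κ h hh
    show ∀ i j (w : PlacesOver E v), Valued.v (((ρ κ).1 + h.1) i j w) ≤ Valued.v (toPlace v w π) ^ (-1 : ℤ)
    exact mball_add F E v (hXball (-1) (hπinv _) (hπinv _) (hπinv _) (hπinv _)) (mball_antitone F E v hπ (by norm_num) (hH0 hh))
  -- (cover) every `t ∈ B(−1)` lies in the coset of `κ = (ϖ·coords) mod 𝔪`
  have hcover : ∀ t ∈ {t : S | ∀ i j (w : PlacesOver E v), Valued.v (t.1 i j w) ≤ Valued.v (toPlace v w π) ^ (-1 : ℤ)}, ∃ κ, -ρ κ + t ∈ H0 := by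
    intro t ht
    obtain ⟨a, b, z₁, z₂, htc⟩ := exists_coords F E c hcδ hδ v hT₀ hT₀d hτ h2F εu hεσ (hsk t)
    have htc' : t.1 = Xc a b z₁ z₂ := htc
    obtain ⟨ha, hb, hz₁, hz₂⟩ := hXcoords (-1) (a := a) (b := b) (z₁ := z₁) (z₂ := z₂) (fun i j w => by rw [← htc']; exact hAm ht i j w)
    refine ⟨(IsLocalRing.residue _ ⟨π * a, hπmul ha⟩, IsLocalRing.residue _ ⟨π * b, hπmul hb⟩,
      IsLocalRing.residue _ ⟨π * z₁, hπmul hz₁⟩, IsLocalRing.residue _ ⟨π * z₂, hπmul hz₂⟩), ?_⟩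
    show ∀ i j (w : PlacesOver E v), Valued.v ((-(ρ _).1 + t.1) i j w) ≤ Valued.v (toPlace v w π) ^ (0 : ℤ)
    rw [hρ, htc', hXneg, hXadd]
    exact hXball 0 (hdiff (hπmul ha)) (hdiff (hπmul hb)) (hdiff (hπmul hz₁)) (hdiff (hπmul hz₂))
  -- (disjoint) distinct `κ` give distinct cosets
  have hdisj : ∀ κ κ', -ρ κ' + ρ κ ∈ H0 → κ = κ' := by
    intro κ κ' hmem
    have h := hH0 hmem
    rw [show (-ρ κ' + ρ κ).1 = -(ρ κ').1 + (ρ κ).1 from rfl, hρ, hρ, hXneg, hXadd] at h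
    obtain ⟨e1, e2, e3, e4⟩ := hXcoords 0 h
    have k1 := hres_eq _ _ e1
    have k2 := hres_eq _ _ e2
    have k3 := hres_eq _ _ e3
    have k4 := hres_eq _ _ e4
    rw [hsec, hsec] at k1 k2 k3 k4
    exact Prod.ext k1 (Prod.ext k2 (Prod.ext k3 k4))
  -- (f) the integrand is constant on cosets
  have hf : ∀ κ (h : S), h ∈ H0 →
      ((ψ (-τ (Matrix.trace (β * (ρ κ + h).1))) : Circle) : ℂ) = ((ψ (-τ (Matrix.trace (β * (ρ κ).1))) : Circle) : ℂ) := by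
    intro κ h hh
    exact addChar_neg_tau_trace_add F E c v hπ hdψ hτ hτadd hβ (ρ κ).1 (hH0 hh)
  -- (D) `D(−1)` meets the `κ`-coset iff `κ₁ κ₂ = κ₃² − d̄ κ₄²`
  have hDval : ∀ κ (h : S), h ∈ H0 → (ρ κ + h ∈ {t : S | ∀ w : PlacesOver E v, Valued.v (t.1.det w) ≤ Valued.v (toPlace v w π) ^ (-1 : ℤ)} ↔
      κ.1 * κ.2.1 - (κ.2.2.1 ^ 2 - IsLocalRing.residue _ ddO * κ.2.2.2 ^ 2) = 0) := by
    intro κ h hh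
    obtain ⟨h₁, h₂, h₃, h₄, hhc⟩ := exists_coords F E c hcδ hδ v hT₀ hT₀d hτ h2F εu hεσ (hsk h)
    have hhc' : h.1 = Xc h₁ h₂ h₃ h₄ := hhc
    obtain ⟨e1, e2, e3, e4⟩ := hXcoords 0 (a := h₁) (b := h₂) (z₁ := h₃) (z₂ := h₄) (fun i j w => by rw [← hhc']; exact hH0 hh i j w)
    rw [hmem0] at e1 e2 e3 e4
    show (∀ w : PlacesOver E v, Valued.v (((ρ κ).1 + h.1).det w) ≤ Valued.v (toPlace v w π) ^ (-1 : ℤ)) ↔ _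
    rw [hρ, hhc', hXadd, hXdet, show (dd : v.adicCompletion F) = (ddO : v.adicCompletion F) from rfl,
      quadric_coset_iff F v hπ _ _ _ _ ddO e1 e2 e3 e4, hsec, hsec, hsec, hsec]
  have hD : ∀ κ (h : S), h ∈ H0 → (ρ κ + h ∈ {t : S | ∀ w : PlacesOver E v, Valued.v (t.1.det w) ≤ Valued.v (toPlace v w π) ^ (-1 : ℤ)} ↔
      ρ κ ∈ {t : S | ∀ w : PlacesOver E v, Valued.v (t.1.det w) ≤ Valued.v (toPlace v w π) ^ (-1 : ℤ)}) := by
    intro κ h hh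
    rw [hDval κ h hh, ← add_zero (ρ κ), hDval κ 0 H0.zero_mem]
  -- (value) the integrand on the `κ`-coset is `ψ₀(d̄ (p̄ κ₁ + r̄ κ₂ + 2(ū₁ κ₃ − d̄ ū₂ κ₄)))`
  have hval : ∀ κ, ((ψ (-τ (Matrix.trace (β * (ρ κ).1))) : Circle) : ℂ) =
      ψ₀ (IsLocalRing.residue _ ddO * (IsLocalRing.residue _ pO * κ.1 + IsLocalRing.residue _ rO * κ.2.1 +
        2 * (IsLocalRing.residue _ u₁O * κ.2.2.1 - IsLocalRing.residue _ ddO * IsLocalRing.residue 𝒪[v.adicCompletion F] u₂O * κ.2.2.2))) :=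
    fun κ => addChar_coset_eq F E c hcδ hδ v hψ₀ hsec ddO pO rO u₁O u₂O hpair' κ
  -- the coset decomposition and the finite sum ★ (HS)
  have hsummand : ∀ κ, Set.indicator {t : S | ∀ w : PlacesOver E v, Valued.v (t.1.det w) ≤ Valued.v (toPlace v w π) ^ (-1 : ℤ)}
      (fun t : S => ((ψ (-τ (Matrix.trace (β * t.1))) : Circle) : ℂ)) (ρ κ) =
      (if κ.1 * κ.2.1 = κ.2.2.1 ^ 2 - IsLocalRing.residue _ ddO * κ.2.2.2 ^ 2 then
        ψ₀ (IsLocalRing.residue _ ddO * IsLocalRing.residue _ pO * κ.1 + IsLocalRing.residue _ ddO * IsLocalRing.residue _ rO * κ.2.1 +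
          2 * (IsLocalRing.residue _ ddO * IsLocalRing.residue _ u₁O * κ.2.2.1 -
            IsLocalRing.residue _ ddO * (IsLocalRing.residue _ ddO * IsLocalRing.residue 𝒪[v.adicCompletion F] u₂O) * κ.2.2.2)) else 0) := by
    intro κ
    have hD0 := hDval κ 0 H0.zero_mem
    rw [add_zero] at hD0
    by_cases hq : κ.1 * κ.2.1 = κ.2.2.1 ^ 2 - IsLocalRing.residue _ ddO * κ.2.2.2 ^ 2
    · rw [Set.indicator_of_mem (hD0.2 (sub_eq_zero.2 hq)), if_pos hq, hval κ]
      congr 1; ring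
    · rw [Set.indicator_of_notMem (fun h => hq (sub_eq_zero.1 (hD0.1 h))), if_neg hq]
  rw [setIntegral_eq_sum_cosets μ H0 (K2LiuSkewLatticeShells.measurableSet_ball F E v hπ 2 S 0) (K2LiuSkewLatticeShells.measure_ball_ne_top F E c v hπ 2 S hS μ 0) ρ
    {t : S | ∀ i j (w : PlacesOver E v), Valued.v (t.1 i j w) ≤ Valued.v (toPlace v w π) ^ (-1 : ℤ)}
    {t : S | ∀ w : PlacesOver E v, Valued.v (t.1.det w) ≤ Valued.v (toPlace v w π) ^ (-1 : ℤ)}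
    (fun t : S => ((ψ (-τ (Matrix.trace (β * t.1))) : Circle) : ℂ)) hcover hA hdisj hf hD, ← Finset.sum_mul]
  show (∑ κ, Set.indicator {t : S | ∀ w : PlacesOver E v, Valued.v (t.1.det w) ≤ Valued.v (toPlace v w π) ^ (-1 : ℤ)}
      (fun t : S => ((ψ (-τ (Matrix.trace (β * t.1))) : Circle) : ℂ)) (ρ κ)) *
      ((μ.real {t : S | ∀ i j (w : PlacesOver E v), Valued.v (t.1 i j w) ≤ Valued.v (toPlace v w π) ^ (0 : ℤ)} : ℝ) : ℂ) = _
  congr 1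
  calc ∑ κ, Set.indicator {t : S | ∀ w : PlacesOver E v, Valued.v (t.1.det w) ≤ Valued.v (toPlace v w π) ^ (-1 : ℤ)}
        (fun t : S => ((ψ (-τ (Matrix.trace (β * t.1))) : Circle) : ℂ)) (ρ κ)
      = ∑ κ : 𝓀[v.adicCompletion F] × 𝓀[v.adicCompletion F] × 𝓀[v.adicCompletion F] × 𝓀[v.adicCompletion F],
          (if κ.1 * κ.2.1 = κ.2.2.1 ^ 2 - IsLocalRing.residue _ ddO * κ.2.2.2 ^ 2 then
            ψ₀ (IsLocalRing.residue _ ddO * IsLocalRing.residue _ pO * κ.1 + IsLocalRing.residue _ ddO * IsLocalRing.residue _ rO * κ.2.1 +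
              2 * (IsLocalRing.residue _ ddO * IsLocalRing.residue _ u₁O * κ.2.2.1 -
                IsLocalRing.residue _ ddO * (IsLocalRing.residue _ ddO * IsLocalRing.residue 𝒪[v.adicCompletion F] u₂O) * κ.2.2.2)) else 0) :=
        Finset.sum_congr rfl fun κ _ => hsummand κ
    _ = (Fintype.card 𝓀[v.adicCompletion F] : ℂ) := by
        rw [sum_prod_four]
        exact sum_hermSingular_addChar hψ₀1 hnsq _ _ _ _ hβ'
    _ = (v.residueCard : ℂ) := by rw [Fintype.card_eq_nat_card, natCard_residueField_eq F v]

end InertPlace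

end Summit.HodgeConjecture.HodgeConjecture.Cruxes.HLiu418.K2LiuSkewResidueQuadricInert

end
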